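import Summits.CriticalPhenomena.PercolationContinuityZ3.Theorems.PercNearOneGluingNoHeavyLowerTailKnQuestion8CoefficientwiseGluing
import HarnessLib

/-!
# The TWO-GADGET two-colouring Harris inequality (prim-lf-2 gen 38) — the PAIR LEMMA of the `|N(z)| = 2` atom

Support file (`--supports stmt-CriticalPhenomena-4575`, closed), prover `prim-lf-2` (gen 38).  No definitions, no named facts, no sorries; standard axioms.
Memo `prim-lf-2/CW-ZONES-gen38.md` §2; notation of `prim-lf-2/CW-PROGRAMME-gen21.md`, `prim-lf-2/CW-LOCALITY-gen33.md` §3.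

Setting.  A multigraph `ends : ι → Sym2 V`, a root `x`, a set `F` of FREE edges (coloured `t ⊔ (F ∖ t)`, uniformly), and two further edge sets
`A, B` ("gadgets": edges that one side may always use).  Write `C(s) = openCluster (ends '' s) x` for the cluster of `x` in an edge set `s`.
For monotone `f, g : Set V → ℝ` put, for `t ⊆ F`,
  `T₁(t) = (f C(t ∪ B) − f C((F∖t) ∪ A)) · (g C(t ∪ B) − g C((F∖t) ∪ A))`       (red side may use `B`, blue side may use `A`),
  `T₂(t) = (f C(t) − f C((F∖t) ∪ A ∪ B)) · (g C(t) − g C((F∖t) ∪ A ∪ B))`       (red side bare, blue side may use both).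
**THEOREM (two-gadget Harris inequality).**  `0 ≤ Σ_{t ⊆ F} (T₁(t) + T₂(t))`  (`Coefficientwise.gadget_twoColouring`).
For `A = B = ∅` this is twice `harris_twoColouring_powerset`.  `Σ T₂ ≥ 0` alone is the reflected off-cluster cell (both means signed); `Σ T₁` alone
is NOT signed (prim-lf-2 gen 38: negative in 818 of 6 000 random instances) — the theorem says the bare/doubly-gadgeted partner always pays for it.
Proof (`Coefficientwise.gadget_abstract`, eight functions on the cube): Harris/FKG (`fkg_powerset`) on each of the eight products gives
`2^{|F|}·Σ(T₁+T₂) ≥ (Sα − Sβ)(Sγ − Sδ) + (Sα₀ − Sβ₁)(Sγ₀ − Sδ₁)` for the sums `S·` of the eight factors; the colour swap `t ↦ F ∖ t` and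
monotonicity of `C` in the edge set give `Sα₀ ≤ Sβ`, `Sα ≤ Sβ₁`, `Sα₀ ≤ Sα`, `Sβ ≤ Sβ₁` (same for `γ, δ`), whence `Sβ₁ − Sα₀ ≥ |Sα − Sβ|`,
`Sδ₁ − Sγ₀ ≥ |Sγ − Sδ|`, and the second product dominates the first.
USE (memo §2, the `|N(z)| = 2` atom of CW-LOCALITY-gen33 §3, `P/2 = D(ab,∅) + D(a,b)` on `H₀ = G − z`): a MIXED cell (`R_a = S_a`, `B_b = T_b`, inside
colourings frozen) with `S_a ∩ T_b = ∅` and the PURE cell obtained from it by recolouring every edge at `T_b` have the same free edges `F` (the edges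
avoiding `S_a ∪ T_b`) and are exactly `Σ T₁` and `Σ T₂` for the gadgets `A = ∂S_a ∪ (E(S_a) ∖ η_a)`, `B = ∂T_b ∪ (E(T_b) ∖ η_b)` and `f = 1_u`, `g = 1_w`;
so every such pair of cells has nonnegative total (the PAIR LEMMA; census: 0 failures among 6.6 M pairs at `n = 7`, `m ≤ 11`, while 350 k mixed cells are
negative).  What is left of the atom is the 'linked' part (memo §2.4).
* `Coefficientwise.gadget_abstract` — the eight-function inequality on `E.powerset`.
* `Coefficientwise.gadget_twoColouring` — the two-gadget Harris inequality for clusters.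
[cite: KozmaNitzan2024, Questions 8–9 (§5.5 p. 36) (context: the Question-8 pocket covariance programme)]
-/

namespace Summit.CriticalPhenomena.PercolationContinuityZ3.Theorems

open Finset Literature.Probability.Percolation

namespace Coefficientwise

variable {ι V : Type*}

section abstract

variable [DecidableEq ι] [Fintype ι]

/-- **Eight-function inequality on the cube** (the abstract form of the two-gadget Harris inequality).  On the colourings `t ⊆ E`, let `α, α₀, γ, γ₀` be
monotone and `β, β₁, δ, δ₁` antitone (as functions on all of `Finset ι`), with `Σ α₀ ≤ Σ β`, `Σ α ≤ Σ β₁`, `Σ α₀ ≤ Σ α`, `Σ β ≤ Σ β₁` and the same four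
inequalities for `γ, γ₀, δ, δ₁` (sums over `E.powerset`).  Then `0 ≤ Σ_{t ⊆ E} ((α t − β t)(γ t − δ t) + (α₀ t − β₁ t)(γ₀ t − δ₁ t))`.
Proof: FKG (`fkg_powerset`) for the eight products, then `(Sβ₁ − Sα₀)(Sδ₁ − Sγ₀) ≥ |Sα − Sβ|·|Sγ − Sδ|`.
[cite: KozmaNitzan2024, §5.5 (context only; the inequality used is Fortuin–Kasteleyn–Ginibre / Harris)] -/
theorem gadget_abstract (E : Finset ι) (α α₀ γ γ₀ β β₁ δ δ₁ : Finset ι → ℝ)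
    (hα : Monotone α) (hα₀ : Monotone α₀) (hγ : Monotone γ) (hγ₀ : Monotone γ₀)
    (hβ : Antitone β) (hβ₁ : Antitone β₁) (hδ : Antitone δ) (hδ₁ : Antitone δ₁)
    (h1 : ∑ t ∈ E.powerset, α₀ t ≤ ∑ t ∈ E.powerset, β t) (h2 : ∑ t ∈ E.powerset, α t ≤ ∑ t ∈ E.powerset, β₁ t)
    (h3 : ∑ t ∈ E.powerset, α₀ t ≤ ∑ t ∈ E.powerset, α t) (h4 : ∑ t ∈ E.powerset, β t ≤ ∑ t ∈ E.powerset, β₁ t)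
    (h1' : ∑ t ∈ E.powerset, γ₀ t ≤ ∑ t ∈ E.powerset, δ t) (h2' : ∑ t ∈ E.powerset, γ t ≤ ∑ t ∈ E.powerset, δ₁ t)
    (h3' : ∑ t ∈ E.powerset, γ₀ t ≤ ∑ t ∈ E.powerset, γ t) (h4' : ∑ t ∈ E.powerset, δ t ≤ ∑ t ∈ E.powerset, δ₁ t) :
    0 ≤ ∑ t ∈ E.powerset, ((α t - β t) * (γ t - δ t) + (α₀ t - β₁ t) * (γ₀ t - δ₁ t)) := by
  -- negations of the antitone functions are monotone
  have hnβ : Monotone (fun t => -β t) := fun a b hab => neg_le_neg (hβ hab)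
  have hnβ₁ : Monotone (fun t => -β₁ t) := fun a b hab => neg_le_neg (hβ₁ hab)
  have hnδ : Monotone (fun t => -δ t) := fun a b hab => neg_le_neg (hδ hab)
  have hnδ₁ : Monotone (fun t => -δ₁ t) := fun a b hab => neg_le_neg (hδ₁ hab)
  -- the eight FKG inequalities
  have i1 := fkg_powerset E α γ hα hγ
  have i2 := fkg_powerset E α (fun t => -δ t) hα hnδ
  have i3 := fkg_powerset E (fun t => -β t) γ hnβ hγ
  have i4 := fkg_powerset E (fun t => -β t) (fun t => -δ t) hnβ hnδ
  have i5 := fkg_powerset E α₀ γ₀ hα₀ hγ₀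
  have i6 := fkg_powerset E α₀ (fun t => -δ₁ t) hα₀ hnδ₁
  have i7 := fkg_powerset E (fun t => -β₁ t) γ₀ hnβ₁ hγ₀
  have i8 := fkg_powerset E (fun t => -β₁ t) (fun t => -δ₁ t) hnβ₁ hnδ₁
  simp only [Finset.sum_neg_distrib, mul_neg, neg_mul, neg_neg] at i2 i3 i4 i6 i7 i8
  -- expand the target sum into the eight product sums
  have hexp : ∑ t ∈ E.powerset, ((α t - β t) * (γ t - δ t) + (α₀ t - β₁ t) * (γ₀ t - δ₁ t)) =
      (∑ t ∈ E.powerset, α t * γ t) - (∑ t ∈ E.powerset, α t * δ t) - (∑ t ∈ E.powerset, β t * γ t) + (∑ t ∈ E.powerset, β t * δ t) +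
      ((∑ t ∈ E.powerset, α₀ t * γ₀ t) - (∑ t ∈ E.powerset, α₀ t * δ₁ t) - (∑ t ∈ E.powerset, β₁ t * γ₀ t) + (∑ t ∈ E.powerset, β₁ t * δ₁ t)) := by
    simp only [sub_mul, mul_sub, Finset.sum_add_distrib, Finset.sum_sub_distrib]
    ring
  have hN : (0 : ℝ) < (2 ^ E.card : ℝ) := by positivity
  -- `p ≥ |x|`, `q ≥ |y|` for p = Sβ₁ − Sα₀, x = Sα − Sβ, q = Sδ₁ − Sγ₀, y = Sγ − Sδ
  have hpx : 0 ≤ ((∑ t ∈ E.powerset, β₁ t) - ∑ t ∈ E.powerset, α₀ t) - ((∑ t ∈ E.powerset, α t) - ∑ t ∈ E.powerset, β t) := by linarith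
  have hpx' : 0 ≤ ((∑ t ∈ E.powerset, β₁ t) - ∑ t ∈ E.powerset, α₀ t) + ((∑ t ∈ E.powerset, α t) - ∑ t ∈ E.powerset, β t) := by linarith
  have hqy : 0 ≤ ((∑ t ∈ E.powerset, δ₁ t) - ∑ t ∈ E.powerset, γ₀ t) - ((∑ t ∈ E.powerset, γ t) - ∑ t ∈ E.powerset, δ t) := by linarith
  have hqy' : 0 ≤ ((∑ t ∈ E.powerset, δ₁ t) - ∑ t ∈ E.powerset, γ₀ t) + ((∑ t ∈ E.powerset, γ t) - ∑ t ∈ E.powerset, δ t) := by linarith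
  have key : 0 ≤ (2 ^ E.card : ℝ) * ∑ t ∈ E.powerset, ((α t - β t) * (γ t - δ t) + (α₀ t - β₁ t) * (γ₀ t - δ₁ t)) := by
    rw [hexp]
    nlinarith [mul_nonneg hpx hqy, mul_nonneg hpx' hqy', i1, i2, i3, i4, i5, i6, i7, i8]
  exact (mul_nonneg_iff_of_pos_left hN).mp key

end abstract

section clusters

variable [DecidableEq ι] [Fintype ι]

open Classical in
/-- **THE TWO-GADGET TWO-COLOURING HARRIS INEQUALITY** (prim-lf-2 gen 38; the PAIR LEMMA of the `|N(z)| = 2` atom).  For a multigraph `ends`,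
a root `x`, a free edge set `F`, gadget edge sets `A, B` and monotone `f, g : Set V → ℝ`, with `C(s) = openCluster (ends '' s) x`:
`0 ≤ Σ_{t ⊆ F} [ (f C(t ∪ B) − f C((F∖t) ∪ A))·(g C(t ∪ B) − g C((F∖t) ∪ A)) + (f C(t) − f C((F∖t) ∪ A ∪ B))·(g C(t) − g C((F∖t) ∪ A ∪ B)) ]`.
[cite: KozmaNitzan2024, Questions 8–9 (§5.5 p. 36) (context)] -/
theorem gadget_twoColouring (ends : ι → Sym2 V) (F A B : Finset ι) (x : V) (f g : Set V → ℝ) (hf : Monotone f) (hg : Monotone g) :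
    0 ≤ ∑ t ∈ F.powerset,
      ((f (openCluster (ends '' (↑(t ∪ B) : Set ι)) x) - f (openCluster (ends '' (↑((F \ t) ∪ A) : Set ι)) x)) *
          (g (openCluster (ends '' (↑(t ∪ B) : Set ι)) x) - g (openCluster (ends '' (↑((F \ t) ∪ A) : Set ι)) x)) +
        (f (openCluster (ends '' (↑t : Set ι)) x) - f (openCluster (ends '' (↑((F \ t) ∪ A ∪ B) : Set ι)) x)) *
          (g (openCluster (ends '' (↑t : Set ι)) x) - g (openCluster (ends '' (↑((F \ t) ∪ A ∪ B) : Set ι)) x))) := by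
  set C : Finset ι → Set V := fun s => openCluster (ends '' (↑s : Set ι)) x with hC
  have hCm : ∀ {s s' : Finset ι}, s ⊆ s' → C s ⊆ C s' := fun h => openCluster_image_mono ends h x
  -- the eight functions, extended monotonically / antitonically to all of `Finset ι`
  set α : Finset ι → ℝ := fun t => f (C ((t ∩ F) ∪ B)) with hα
  set α₀ : Finset ι → ℝ := fun t => f (C (t ∩ F)) with hα₀
  set γ : Finset ι → ℝ := fun t => g (C ((t ∩ F) ∪ B)) with hγ
  set γ₀ : Finset ι → ℝ := fun t => g (C (t ∩ F)) with hγ₀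
  set β : Finset ι → ℝ := fun t => f (C ((F \ t) ∪ A)) with hβ
  set β₁ : Finset ι → ℝ := fun t => f (C ((F \ t) ∪ A ∪ B)) with hβ₁
  set δ : Finset ι → ℝ := fun t => g (C ((F \ t) ∪ A)) with hδ
  set δ₁ : Finset ι → ℝ := fun t => g (C ((F \ t) ∪ A ∪ B)) with hδ₁
  have mα : Monotone α := fun a b hab => hf (hCm (Finset.union_subset_union (Finset.inter_subset_inter_right hab) le_rfl))
  have mα₀ : Monotone α₀ := fun a b hab => hf (hCm (Finset.inter_subset_inter_right hab))
  have mγ : Monotone γ := fun a b hab => hg (hCm (Finset.union_subset_union (Finset.inter_subset_inter_right hab) le_rfl))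
  have mγ₀ : Monotone γ₀ := fun a b hab => hg (hCm (Finset.inter_subset_inter_right hab))
  have sd : ∀ {a b : Finset ι}, a ⊆ b → F \ b ⊆ F \ a := fun hab => Finset.sdiff_subset_sdiff le_rfl hab
  have mβ : Antitone β := fun a b hab => hf (hCm (Finset.union_subset_union (sd hab) le_rfl))
  have mβ₁ : Antitone β₁ := fun a b hab => hf (hCm (Finset.union_subset_union (Finset.union_subset_union (sd hab) le_rfl) le_rfl))
  have mδ : Antitone δ := fun a b hab => hg (hCm (Finset.union_subset_union (sd hab) le_rfl))
  have mδ₁ : Antitone δ₁ := fun a b hab => hg (hCm (Finset.union_subset_union (Finset.union_subset_union (sd hab) le_rfl) le_rfl))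
  -- on `t ⊆ F`, `t ∩ F = t`
  have hin : ∀ t ∈ F.powerset, t ∩ F = t := fun t ht => Finset.inter_eq_left.mpr (Finset.mem_powerset.mp ht)
  -- the four mean inequalities for `f` (and for `g`): colour swap `t ↦ F ∖ t` plus monotonicity
  have mean1 : ∀ (φ : Set V → ℝ), Monotone φ →
      ∑ t ∈ F.powerset, φ (C (t ∩ F)) ≤ ∑ t ∈ F.powerset, φ (C ((F \ t) ∪ A)) := by
    intro φ hφ
    rw [← sum_powerset_sdiff F (fun s => φ (C ((F \ s) ∪ A)))]
    refine Finset.sum_le_sum fun t ht => ?_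
    rw [hin t ht, Finset.sdiff_sdiff_eq_self (Finset.mem_powerset.mp ht)]
    exact hφ (hCm Finset.subset_union_left)
  have mean2 : ∀ (φ : Set V → ℝ), Monotone φ →
      ∑ t ∈ F.powerset, φ (C ((t ∩ F) ∪ B)) ≤ ∑ t ∈ F.powerset, φ (C ((F \ t) ∪ A ∪ B)) := by
    intro φ hφ
    rw [← sum_powerset_sdiff F (fun s => φ (C ((F \ s) ∪ A ∪ B)))]
    refine Finset.sum_le_sum fun t ht => ?_
    rw [hin t ht, Finset.sdiff_sdiff_eq_self (Finset.mem_powerset.mp ht)]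
    exact hφ (hCm (Finset.union_subset_union Finset.subset_union_left le_rfl))
  have mean3 : ∀ (φ : Set V → ℝ), Monotone φ →
      ∑ t ∈ F.powerset, φ (C (t ∩ F)) ≤ ∑ t ∈ F.powerset, φ (C ((t ∩ F) ∪ B)) :=
    fun φ hφ => Finset.sum_le_sum fun t _ => hφ (hCm Finset.subset_union_left)
  have mean4 : ∀ (φ : Set V → ℝ), Monotone φ →
      ∑ t ∈ F.powerset, φ (C ((F \ t) ∪ A)) ≤ ∑ t ∈ F.powerset, φ (C ((F \ t) ∪ A ∪ B)) :=
    fun φ hφ => Finset.sum_le_sum fun t _ => hφ (hCm Finset.subset_union_left)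
  have key := gadget_abstract F α α₀ γ γ₀ β β₁ δ δ₁ mα mα₀ mγ mγ₀ mβ mβ₁ mδ mδ₁
    (mean1 f hf) (mean2 f hf) (mean3 f hf) (mean4 f hf) (mean1 g hg) (mean2 g hg) (mean3 g hg) (mean4 g hg)
  -- identify the summands on `F.powerset`
  have hsame : ∀ t ∈ F.powerset, ((α t - β t) * (γ t - δ t) + (α₀ t - β₁ t) * (γ₀ t - δ₁ t)) =
      ((f (C (t ∪ B)) - f (C ((F \ t) ∪ A))) * (g (C (t ∪ B)) - g (C ((F \ t) ∪ A))) +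
        (f (C t) - f (C ((F \ t) ∪ A ∪ B))) * (g (C t) - g (C ((F \ t) ∪ A ∪ B)))) := by
    intro t ht
    simp only [hα, hα₀, hγ, hγ₀, hβ, hβ₁, hδ, hδ₁, hin t ht]
  rw [Finset.sum_congr rfl hsame] at key
  exact key

open Classical in
/-- **Two-gadget Harris inequality with a LARGER blue gadget for the partner** (prim-lf-2 gen 38, memo CW-GADGET-gen38 §2.2 remark): for gadget edge sets
`A, B ⊆ Γ`, `0 ≤ Σ_{t ⊆ F} [ (f C(t ∪ B) − f C((F∖t) ∪ A))·(g C(t ∪ B) − g C((F∖t) ∪ A)) + (f C(t) − f C((F∖t) ∪ Γ))·(g C(t) − g C((F∖t) ∪ Γ)) ]` — the partner may be blue-reinforced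
beyond `A ∪ B` (used for the LINKED cells of the `|N(z)| = 2` atom, whose partners carry extra blue structure at the common core `J`).  Same proof: the four mean inequalities
only improve when `Γ` grows.  [cite: KozmaNitzan2024, Questions 8–9 (§5.5 p. 36) (context)] -/
theorem gadget_twoColouring_of_subset (ends : ι → Sym2 V) (F A B Γ : Finset ι) (hA : A ⊆ Γ) (hB : B ⊆ Γ) (x : V) (f g : Set V → ℝ)
    (hf : Monotone f) (hg : Monotone g) :
    0 ≤ ∑ t ∈ F.powerset,
      ((f (openCluster (ends '' (↑(t ∪ B) : Set ι)) x) - f (openCluster (ends '' (↑((F \ t) ∪ A) : Set ι)) x)) *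
          (g (openCluster (ends '' (↑(t ∪ B) : Set ι)) x) - g (openCluster (ends '' (↑((F \ t) ∪ A) : Set ι)) x)) +
        (f (openCluster (ends '' (↑t : Set ι)) x) - f (openCluster (ends '' (↑((F \ t) ∪ Γ) : Set ι)) x)) *
          (g (openCluster (ends '' (↑t : Set ι)) x) - g (openCluster (ends '' (↑((F \ t) ∪ Γ) : Set ι)) x))) := by
  set C : Finset ι → Set V := fun s => openCluster (ends '' (↑s : Set ι)) x with hC
  have hCm : ∀ {s s' : Finset ι}, s ⊆ s' → C s ⊆ C s' := fun h => openCluster_image_mono ends h x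
  set α : Finset ι → ℝ := fun t => f (C ((t ∩ F) ∪ B)) with hα
  set α₀ : Finset ι → ℝ := fun t => f (C (t ∩ F)) with hα₀
  set γ : Finset ι → ℝ := fun t => g (C ((t ∩ F) ∪ B)) with hγ
  set γ₀ : Finset ι → ℝ := fun t => g (C (t ∩ F)) with hγ₀
  set β : Finset ι → ℝ := fun t => f (C ((F \ t) ∪ A)) with hβ
  set β₁ : Finset ι → ℝ := fun t => f (C ((F \ t) ∪ Γ)) with hβ₁
  set δ : Finset ι → ℝ := fun t => g (C ((F \ t) ∪ A)) with hδ
  set δ₁ : Finset ι → ℝ := fun t => g (C ((F \ t) ∪ Γ)) with hδ₁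
  have mα : Monotone α := fun a b hab => hf (hCm (Finset.union_subset_union (Finset.inter_subset_inter_right hab) le_rfl))
  have mα₀ : Monotone α₀ := fun a b hab => hf (hCm (Finset.inter_subset_inter_right hab))
  have mγ : Monotone γ := fun a b hab => hg (hCm (Finset.union_subset_union (Finset.inter_subset_inter_right hab) le_rfl))
  have mγ₀ : Monotone γ₀ := fun a b hab => hg (hCm (Finset.inter_subset_inter_right hab))
  have sd : ∀ {a b : Finset ι}, a ⊆ b → F \ b ⊆ F \ a := fun hab => Finset.sdiff_subset_sdiff le_rfl hab
  have mβ : Antitone β := fun a b hab => hf (hCm (Finset.union_subset_union (sd hab) le_rfl))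
  have mβ₁ : Antitone β₁ := fun a b hab => hf (hCm (Finset.union_subset_union (sd hab) le_rfl))
  have mδ : Antitone δ := fun a b hab => hg (hCm (Finset.union_subset_union (sd hab) le_rfl))
  have mδ₁ : Antitone δ₁ := fun a b hab => hg (hCm (Finset.union_subset_union (sd hab) le_rfl))
  have hin : ∀ t ∈ F.powerset, t ∩ F = t := fun t ht => Finset.inter_eq_left.mpr (Finset.mem_powerset.mp ht)
  have mean1 : ∀ (φ : Set V → ℝ), Monotone φ →
      ∑ t ∈ F.powerset, φ (C (t ∩ F)) ≤ ∑ t ∈ F.powerset, φ (C ((F \ t) ∪ A)) := by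
    intro φ hφ
    rw [← sum_powerset_sdiff F (fun s => φ (C ((F \ s) ∪ A)))]
    refine Finset.sum_le_sum fun t ht => ?_
    rw [hin t ht, Finset.sdiff_sdiff_eq_self (Finset.mem_powerset.mp ht)]
    exact hφ (hCm Finset.subset_union_left)
  have mean2 : ∀ (φ : Set V → ℝ), Monotone φ →
      ∑ t ∈ F.powerset, φ (C ((t ∩ F) ∪ B)) ≤ ∑ t ∈ F.powerset, φ (C ((F \ t) ∪ Γ)) := by
    intro φ hφ
    rw [← sum_powerset_sdiff F (fun s => φ (C ((F \ s) ∪ Γ)))]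
    refine Finset.sum_le_sum fun t ht => ?_
    rw [hin t ht, Finset.sdiff_sdiff_eq_self (Finset.mem_powerset.mp ht)]
    exact hφ (hCm (Finset.union_subset_union le_rfl hB))
  have mean3 : ∀ (φ : Set V → ℝ), Monotone φ →
      ∑ t ∈ F.powerset, φ (C (t ∩ F)) ≤ ∑ t ∈ F.powerset, φ (C ((t ∩ F) ∪ B)) :=
    fun φ hφ => Finset.sum_le_sum fun t _ => hφ (hCm Finset.subset_union_left)
  have mean4 : ∀ (φ : Set V → ℝ), Monotone φ →
      ∑ t ∈ F.powerset, φ (C ((F \ t) ∪ A)) ≤ ∑ t ∈ F.powerset, φ (C ((F \ t) ∪ Γ)) :=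
    fun φ hφ => Finset.sum_le_sum fun t _ => hφ (hCm (Finset.union_subset_union le_rfl hA))
  have key := gadget_abstract F α α₀ γ γ₀ β β₁ δ δ₁ mα mα₀ mγ mγ₀ mβ mβ₁ mδ mδ₁
    (mean1 f hf) (mean2 f hf) (mean3 f hf) (mean4 f hf) (mean1 g hg) (mean2 g hg) (mean3 g hg) (mean4 g hg)
  have hsame : ∀ t ∈ F.powerset, ((α t - β t) * (γ t - δ t) + (α₀ t - β₁ t) * (γ₀ t - δ₁ t)) =
      ((f (C (t ∪ B)) - f (C ((F \ t) ∪ A))) * (g (C (t ∪ B)) - g (C ((F \ t) ∪ A))) +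
        (f (C t) - f (C ((F \ t) ∪ Γ))) * (g (C t) - g (C ((F \ t) ∪ Γ)))) := by
    intro t ht
    simp only [hα, hα₀, hγ, hγ₀, hβ, hβ₁, hδ, hδ₁, hin t ht]
  rw [Finset.sum_congr rfl hsame] at key
  exact key

open Classical in
/-- **CYLINDER PAIRING** (prim-lf-2 gen 38, memo CW-GADGET-gen38 §2.2b).  On an edge set `E` fix a set `B₀ ⊆ E` of frozen edges and a pattern `π ⊆ B₀`; the cylinder
`{t ⊆ E : t ∩ B₀ = π}` has, literally, red cluster `C_x((t∖B₀) ∪ π)` and blue cluster `C_x(((E∖B₀)∖(t∖B₀)) ∪ (B₀∖π))` — one gadget per colour — so by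
`gadget_twoColouring_of_subset` (blue partner gadget `Γ = B₀`) the cylinder is paid by the ALL-BLUE cylinder on the same frozen set:
`0 ≤ Σ_{t ⊆ E, t ∩ B₀ = π} Δf Δg + Σ_{t ⊆ E, t ∩ B₀ = ∅} Δf Δg`, `Δf(t) = f(C_x t) − f(C_x(E∖t))`, for all monotone `f, g` (wall-free; `B₀ = ∅`: twice Harris).
[cite: KozmaNitzan2024, Questions 8–9 (§5.5 p. 36) (context)] -/
theorem cylinder_pairing (ends : ι → Sym2 V) (E B₀ π : Finset ι) (hB₀ : B₀ ⊆ E) (hπ : π ⊆ B₀) (x : V) (f g : Set V → ℝ)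
    (hf : Monotone f) (hg : Monotone g) :
    0 ≤ (∑ t ∈ E.powerset.filter (fun t : Finset ι => t ∩ B₀ = π),
        (f (openCluster (ends '' (↑t : Set ι)) x) - f (openCluster (ends '' (↑(E \ t) : Set ι)) x)) *
          (g (openCluster (ends '' (↑t : Set ι)) x) - g (openCluster (ends '' (↑(E \ t) : Set ι)) x))) +
      ∑ t ∈ E.powerset.filter (fun t : Finset ι => t ∩ B₀ = ∅),
        (f (openCluster (ends '' (↑t : Set ι)) x) - f (openCluster (ends '' (↑(E \ t) : Set ι)) x)) *
          (g (openCluster (ends '' (↑t : Set ι)) x) - g (openCluster (ends '' (↑(E \ t) : Set ι)) x)) := by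
  set F : Finset ι := E \ B₀ with hF
  set C : Finset ι → Set V := fun s => openCluster (ends '' (↑s : Set ι)) x with hC
  -- reindex a cylinder by its free part: t = ω ∪ ρ with ω ⊆ F
  have reindex : ∀ ρ : Finset ι, ρ ⊆ B₀ → ∀ h : Finset ι → ℝ,
      ∑ t ∈ E.powerset.filter (fun t : Finset ι => t ∩ B₀ = ρ), h t = ∑ ω ∈ F.powerset, h (ω ∪ ρ) := by
    intro ρ hρ h
    symm
    refine Finset.sum_nbij' (fun ω => ω ∪ ρ) (fun t => t \ B₀) ?_ ?_ ?_ ?_ ?_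
    · intro ω hω
      have hωF : ω ⊆ F := Finset.mem_powerset.mp hω
      rw [Finset.mem_filter, Finset.mem_powerset]
      refine ⟨Finset.union_subset (fun i hi => (Finset.mem_sdiff.mp (hωF hi)).1) (fun i hi => hB₀ (hρ hi)), ?_⟩
      ext i
      simp only [Finset.mem_inter, Finset.mem_union]
      constructor
      · rintro ⟨hi | hi, hiB⟩
        · exact absurd hiB (Finset.mem_sdiff.mp (hωF hi)).2
        · exact hi
      · intro hi
        exact ⟨Or.inr hi, hρ hi⟩
    · intro t ht
      exact Finset.mem_powerset.mpr (Finset.sdiff_subset_sdiff (Finset.mem_powerset.mp (Finset.mem_filter.mp ht).1) le_rfl)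
    · intro ω hω
      have hωF : ω ⊆ F := Finset.mem_powerset.mp hω
      ext i
      simp only [Finset.mem_sdiff, Finset.mem_union]
      constructor
      · rintro ⟨hi | hi, hiB⟩
        · exact hi
        · exact absurd (hρ hi) hiB
      · intro hi
        exact ⟨Or.inl hi, (Finset.mem_sdiff.mp (hωF hi)).2⟩
    · intro t ht
      have hti : t ∩ B₀ = ρ := (Finset.mem_filter.mp ht).2
      ext i
      simp only [Finset.mem_union, Finset.mem_sdiff]
      constructor
      · rintro (⟨hi, _⟩ | hi)
        · exact hi
        · have : i ∈ t ∩ B₀ := by rw [hti]; exact hi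
          exact (Finset.mem_inter.mp this).1
      · intro hi
        by_cases hiB : i ∈ B₀
        · right; rw [← hti]; exact Finset.mem_inter.mpr ⟨hi, hiB⟩
        · left; exact ⟨hi, hiB⟩
    · intro ω _; rfl
  -- complements: E ∖ (ω ∪ ρ) = (F ∖ ω) ∪ (B₀ ∖ ρ) for ω ⊆ F
  have compl_eq : ∀ ρ : Finset ι, ρ ⊆ B₀ → ∀ ω : Finset ι, ω ⊆ F → E \ (ω ∪ ρ) = (F \ ω) ∪ (B₀ \ ρ) := by
    intro ρ hρ ω hω
    ext i
    simp only [Finset.mem_sdiff, Finset.mem_union, not_or, hF]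
    constructor
    · rintro ⟨hiE, hiω, hiρ⟩
      by_cases hiB : i ∈ B₀
      · exact Or.inr ⟨hiB, hiρ⟩
      · exact Or.inl ⟨⟨hiE, hiB⟩, hiω⟩
    · rintro (⟨⟨hiE, hiB⟩, hiω⟩ | ⟨hiB, hiρ⟩)
      · exact ⟨hiE, hiω, fun h => hiB (hρ h)⟩
      · refine ⟨hB₀ hiB, fun h => ?_, hiρ⟩
        have := Finset.mem_sdiff.mp (by rw [hF] at hω; exact hω h)
        exact this.2 hiB
  rw [reindex π hπ, reindex ∅ (Finset.empty_subset _)]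
  have key := gadget_twoColouring_of_subset ends F (B₀ \ π) π B₀ Finset.sdiff_subset hπ x f g hf hg
  have hsame1 : ∀ ω ∈ F.powerset,
      (f (C (ω ∪ π)) - f (C ((F \ ω) ∪ (B₀ \ π)))) * (g (C (ω ∪ π)) - g (C ((F \ ω) ∪ (B₀ \ π)))) =
      (f (C (ω ∪ π)) - f (C (E \ (ω ∪ π)))) * (g (C (ω ∪ π)) - g (C (E \ (ω ∪ π)))) := by
    intro ω hω
    rw [compl_eq π hπ ω (Finset.mem_powerset.mp hω)]
  have hsame2 : ∀ ω ∈ F.powerset,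
      (f (C ω) - f (C ((F \ ω) ∪ B₀))) * (g (C ω) - g (C ((F \ ω) ∪ B₀))) =
      (f (C (ω ∪ ∅)) - f (C (E \ (ω ∪ ∅)))) * (g (C (ω ∪ ∅)) - g (C (E \ (ω ∪ ∅)))) := by
    intro ω hω
    have h := compl_eq ∅ (Finset.empty_subset _) ω (Finset.mem_powerset.mp hω)
    rw [Finset.sdiff_empty] at h
    rw [h, Finset.union_empty]
  rw [← Finset.sum_add_distrib]
  have hsame : ∀ ω ∈ F.powerset,
      (f (C (ω ∪ π)) - f (C ((F \ ω) ∪ (B₀ \ π)))) * (g (C (ω ∪ π)) - g (C ((F \ ω) ∪ (B₀ \ π)))) +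
        (f (C ω) - f (C ((F \ ω) ∪ B₀))) * (g (C ω) - g (C ((F \ ω) ∪ B₀))) =
      (f (C (ω ∪ π)) - f (C (E \ (ω ∪ π)))) * (g (C (ω ∪ π)) - g (C (E \ (ω ∪ π)))) +
        (f (C (ω ∪ ∅)) - f (C (E \ (ω ∪ ∅)))) * (g (C (ω ∪ ∅)) - g (C (E \ (ω ∪ ∅)))) := by
    intro ω hω
    rw [hsame1 ω hω, hsame2 ω hω]
  rw [Finset.sum_congr rfl hsame] at key
  exact key

end clusters

end Coefficientwise

end Summit.CriticalPhenomena.PercolationContinuityZ3.Theorems
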